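import Literature.MathematicalPhysics.QuantumFieldTheory.Balaban1983to89.B9B8KnitAveragingClosenessOfColumns
import Literature.MathematicalPhysics.QuantumFieldTheory.Balaban1983to89.B9B8KnitNeumannCore

/-!
# `Balaban1983to89.B9B8KnitAveragingClosenessWeighted` — the (B)-line bond junction, file c7: THE DISPLAYED AVERAGING HYPOTHESIS `hQQ` OF FILES 5 ∕ 8c
# IN ITS OWN CURRENCY (`|·|₍₋₃₎ ≤ ε_Q|·|₍₋₁₎`) FROM THE COLUMN-LEVEL INEQUALITIES (H1)–(H3) OF FILE c6 — per background, for ALL bond functions `a`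
# (a fortiori the Hermitian ones), with `ε_Q = (w₋₃∕w₋₁)·(c_fη)²·w_n·2(d+1)·C_τβ_τ·(δ₁C₃ + LⁿL^{-n(d+1)}δ₂)`

statement-level skeleton of published theorems with citation tags; proofs where landed; nothing here is a claim about the
Yang–Mills mass gap

Sub-row G-B8-T2S (unit `lit-balaban-t2s-1`, gen 7), RULING #10 road, crux (c′) (`g7/BLINE-DESIGN-g7.md` §4).  File c6's sharp edition
(`norm_QsY_aY_QY_sub_QQZdP_le_of_columns_sharp`) bounds the difference of the two averaging letters AT ONE FINE BOND by `ε′·‖a‖`; at a constant-level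
member both weighted sup-norms are `weight × sup` (`B9B8KnitNeumannCore.wNormBY_eq_weight_mul_norm`), so the displayed `hQQ` of
`B9B8KnitClosenessOfSectors.sockB9P3Per_torusIdx_of_sectors` ∕ `B9B8KnitTorusSocketBetaZero.sockB9P3Per_torusIdx_of_sectors₀` follows with
`ε_Q = (w₋₃∕w₋₁)·ε′` (`w_α = weight L |c_f|⁻¹ α n`; by `B9B8KnitNormsTransfer.weight_defY_eq_mul_weight_knit` the ratio is `(c_fη)^{-2}(Lⁿη)²`).
Print: [4] (3.16) p. 393, (3.26) p. 395, (3.41) p. 397; [B8] (1.58)–(1.59) p. 86.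

WHAT IS PROVED (kernel, 0 sorry; theorems only, no `def`, no `… : Prop` fact, no `instance`).
* ★★★ `hQQ_of_columns` — per background `U₀` (regime `Reg17`), def-Y configuration `U` with unitary transporters `qT parB U`: (H1)–(H3) for every fine bond
  ⟹ `∀ a, |Q*(U)aQ(U)a − (c_fη)²·(QQZdP(U₀)a♯)♭|₍₋₃₎ ≤ ε_Q·|a|₍₋₁₎`, the exact shape of file 5's `hQQ` (which asks it for Hermitian `a` only).

HONEST SCOPE.  Weight bookkeeping over c6; (H1)–(H3) stay DISPLAYED; count-neutral; nothing continuum ∕ ℝ⁴ ∕ OS ∕ mass gap ∕ Clay — the Yang–Mills mass gap is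
NOT proved here.  NEW file; c6 and the norm dictionaries are used BY NAME, nothing landed is modified.
-/

noncomputable section

namespace Literature.MathematicalPhysics.QuantumFieldTheory.Balaban1983to89.B9B8KnitAveragingClosenessWeighted

open scoped BigOperators
open Node00
open B7Prop1Explicit renaming Site → LSite
open B7Prop2Explicit (unitaryUnits)
open B6KLevelCensusIndexV1 (KIdx)
open B6GlobalChartV1 (PV)
open B8ScaledSupNorm (weight)
open B7Prop4GeneralLevels (linCovIter)
open B7Prop5Flat (bump)
open B10Eq27TorusAxialLog (transl rel)
open B9B8KnitBondTransfer (liftBd descBd)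
open B9B8KnitNormsTransfer (weight_level_pos)
open B9B8KnitNeumannCore (wNormBY_eq_weight_mul_norm)
open B9B8KnitAveragingClosenessOfColumns (norm_QsY_aY_QY_sub_QQZdP_le_of_columns_sharp)
open B9Eq316AveragingTransposeZd (betaTau winBase clsField wQ alphaQ Reg17)
open B9Eq316AveragingTransposeZdPrinted (QQZdP)
open B8Thm2TorusMember (TorusMember torusIdx torusLamb)
open B9Eq39Adjoint (R)

variable {d ℓ : ℕ} {hd : 1 ≤ d + 1} {hL : Odd (ℓ + 1) ∧ 1 < ℓ + 1} {b₀ b₁ : ℝ}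
variable {𝔸 : Type} [CStarAlgebra 𝔸] [Nontrivial 𝔸] [FiniteDimensional ℝ 𝔸] (τ : 𝔸 →ₗ[ℂ] ℂ) (i : KIdx d ℓ hd hL b₀ b₁) {n : ℕ}

/-- ★★★ **`hQQ` FROM THE COLUMN-LEVEL INEQUALITIES.**  At a member of constant level `n` (nominal index `n + 1`, every site of level `n`) with the
`b₀ = 1` band weight, a def-Y configuration `U` whose transporters `qT parB U ι f` are unitary, a background `U₀` in the regime `Reg17 L n ℤ^{d+1} (α_Q∕L²)`,
a faithful tracial `τ` with `|Re τ(x*y)| ≤ C_τ‖x‖‖y‖`: if (H1)–(H3) of file c6 hold at every fine bond, then for EVERY bond function `a`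
`|Q*(U)aQ(U)a − (c_fη)²·(QQZdP(U₀)a♯)♭|₍₋₃₎ ≤ ε_Q·|a|₍₋₁₎` with `ε_Q = (w₋₃∕w₋₁)·(c_fη)²·w_n·2(d+1)·C_τβ_τ·(δ₁C₃ + LⁿL^{-n(d+1)}δ₂)`.
[cite: Balaban1985BackgroundPropagators, (3.16) p.393, (3.26) p.395, (3.41) p.397; Balaban1985RegularSpaces, (1.58)–(1.59) p.86; Balaban1985Averaging, (147) p.40] -/
theorem hQQ_of_columns (hτp : ∀ a : 𝔸, a ≠ 0 → 0 < (τ (star a * a)).re) (hτt : ∀ a b : 𝔸, τ (a * b) = τ (b * a))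
    {Cτ : ℝ} (hCτ : ∀ x y : 𝔸, |(τ (star x * y)).re| ≤ Cτ * ‖x‖ * ‖y‖)
    (hD : ∀ x, i.D.lev x = n) (hk : i.k = n + 1) (hlev : ∀ z : SiteY i, levY i z = n)
    (hw : ∀ ι : IBondY i, i.w ι = i.cf ^ 2 * (((((ℓ + 1 : ℕ) : ℝ)) ^ (ι.1.1 : ℕ)) ^ (d + 1) * (1 / (((ℓ + 1 : ℕ) : ℝ)) ^ (ι.1.1 : ℕ)) ^ 2))
    (hL1 : 1 ≤ ℓ + 1) {η : ℝ} (hη : 0 < η) {k : ℕ} (hk1 : 1 ≤ k)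
    (parB : BondParY 𝔸 i) (U : CfgY 𝔸 i) (hunit : ∀ (ι : IBondY i) (f : FBondY i), qT i parB U ι f ∈ unitaryUnits 𝔸)
    (U₀ : LSite (d + 1) → Fin (d + 1) → 𝔸ˣ)
    (hreg : Reg17 (ℓ + 1) n (fun _ => (Set.univ : Set (LSite (d + 1)))) (alphaQ (d + 1) (ℓ + 1) / ((ℓ + 1 : ℕ) : ℝ) ^ 2) U₀)
    {δ₁ δ₂ C₃ : ℝ} (hδ₁ : 0 ≤ δ₁) (hδ₂ : 0 ≤ δ₂)
    (H1 : ∀ (f : FBondY i) (ι : IBondY i) (κ : Fin (d + 1)) (t : Fin 2),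
      ι.1.2.src = transl (0 : Site (PV d ℓ i.m i.K hd hL) (ι.1.1 : ℕ))
        (winBase (ℓ + 1) n (rel (0 : Site (PV d ℓ i.m i.K hd hL) 0) f.src) κ t) → ι.1.2.dir = κ →
      ∀ X : 𝔸, ‖linCovIter (ℓ + 1) U₀ (bump (rel (0 : Site (PV d ℓ i.m i.K hd hL) 0) f.src) f.dir X) n
          (winBase (ℓ + 1) n (rel (0 : Site (PV d ℓ i.m i.K hd hL) 0) f.src) κ t) κ -
        (((((ℓ + 1 : ℕ) : ℝ)) ^ n * qK i ι f : ℝ) : ℂ) • R (qT i parB U ι f) X‖ ≤ δ₁ * ‖X‖)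
    (H2 : ∀ (a : FBondY i → 𝔸) (f : FBondY i) (ι : IBondY i) (t : Fin 2),
      ι.1.2.src = transl (0 : Site (PV d ℓ i.m i.K hd hL) (ι.1.1 : ℕ))
        (winBase (ℓ + 1) n (rel (0 : Site (PV d ℓ i.m i.K hd hL) 0) f.src) f.dir t) → ι.1.2.dir = f.dir →
      ‖clsField (ℓ + 1) (fun m' => torusLamb (d := d + 1) m') η n n U₀ (liftBd i a)
          (winBase (ℓ + 1) n (rel (0 : Site (PV d ℓ i.m i.K hd hL) 0) f.src) f.dir t) f.dir -
        ((η * (((ℓ + 1 : ℕ) : ℝ)) ^ n : ℝ) : ℂ) • QY i parB U a ι‖ ≤ δ₂ * ‖a‖)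
    (H3 : ∀ (a : FBondY i → 𝔸) (f : FBondY i) (κ : Fin (d + 1)) (t : Fin 2),
      ‖clsField (ℓ + 1) (fun m' => torusLamb (d := d + 1) m') η n n U₀ (liftBd i a)
          (winBase (ℓ + 1) n (rel (0 : Site (PV d ℓ i.m i.K hd hL) 0) f.src) κ t) κ‖ ≤ C₃ * ‖a‖)
    (a : FBondY i → 𝔸) :
    wNormBY i (-3) (QsY i parB U (aY i (QY i parB U a)) -
        ((i.cf * η) ^ 2 : ℝ) • descBd i (QQZdP τ (ℓ + 1) (fun m' => torusLamb (d := d + 1) m') (torusIdx (d := d + 1) hL1 ⟨η, hη, k, hk1⟩) n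
          U₀ (liftBd i a))) ≤
      (weight (ℓ + 1) |i.cf|⁻¹ (-3) n / weight (ℓ + 1) |i.cf|⁻¹ (-1) n *
        ((i.cf * η) ^ 2 * wQ (d := d + 1) (ℓ + 1) η n *
          (2 * ((d : ℝ) + 1) * (Cτ * betaTau τ * (δ₁ * C₃ +
            ((((ℓ + 1 : ℕ) : ℝ)) ^ n * (((((ℓ + 1 : ℕ) : ℝ)) ^ (d + 1)) ^ n)⁻¹) * δ₂))))) * wNormBY i (-1) a := by
  set ε' : ℝ := (i.cf * η) ^ 2 * wQ (d := d + 1) (ℓ + 1) η n *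
    (2 * ((d : ℝ) + 1) * (Cτ * betaTau τ * (δ₁ * C₃ + ((((ℓ + 1 : ℕ) : ℝ)) ^ n * (((((ℓ + 1 : ℕ) : ℝ)) ^ (d + 1)) ^ n)⁻¹) * δ₂))) with hε'
  set E := QsY i parB U (aY i (QY i parB U a)) -
    ((i.cf * η) ^ 2 : ℝ) • descBd i (QQZdP τ (ℓ + 1) (fun m' => torusLamb (d := d + 1) m') (torusIdx (d := d + 1) hL1 ⟨η, hη, k, hk1⟩) n
      U₀ (liftBd i a)) with hE
  set w₁ : ℝ := weight (ℓ + 1) |i.cf|⁻¹ (-1) n with hw₁def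
  set w₃ : ℝ := weight (ℓ + 1) |i.cf|⁻¹ (-3) n with hw₃def
  have hw₁ : 0 < w₁ := weight_level_pos i (-1 : ℝ) n
  have hw₃ : 0 < w₃ := weight_level_pos i (-3 : ℝ) n
  -- the per-bond bound of file c6 (sharp edition)
  have hpt : ∀ f : FBondY i, ‖E f‖ ≤ ε' * ‖a‖ := fun f => by
    rw [hE, Pi.sub_apply, Pi.smul_apply]
    exact norm_QsY_aY_QY_sub_QQZdP_le_of_columns_sharp τ i hτp hτt hCτ hD hk hw hL1 hη hk1 parB U a f (fun ι => hunit ι f) U₀ hreg hδ₁ hδ₂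
      (H1 f) (H2 a f) (H3 a f)
  have hε0 : 0 ≤ ε' * ‖a‖ := (norm_nonneg _).trans (hpt ⟨0, 0⟩)
  have hsup : ‖E‖ ≤ ε' * ‖a‖ := (pi_norm_le_iff_of_nonneg hε0).2 hpt
  rw [wNormBY_eq_weight_mul_norm i hlev, wNormBY_eq_weight_mul_norm i hlev]
  calc w₃ * ‖E‖ ≤ w₃ * (ε' * ‖a‖) := mul_le_mul_of_nonneg_left hsup hw₃.le
    _ = w₃ / w₁ * ε' * (w₁ * ‖a‖) := by
        rw [show w₃ / w₁ * ε' * (w₁ * ‖a‖) = w₃ / w₁ * w₁ * (ε' * ‖a‖) by ring, div_mul_cancel₀ _ hw₁.ne']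

end Literature.MathematicalPhysics.QuantumFieldTheory.Balaban1983to89.B9B8KnitAveragingClosenessWeighted
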